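import Summits.QuantumFields.YangMills.Theorems.UnitScaleTiltProp7HPcolNegPauliExp
import Literature.MathematicalPhysics.QuantumFieldTheory.Balaban1983to89.T3PrintedRegularMinimiser
import Literature.MathematicalPhysics.QuantumFieldTheory.Balaban1983to89.Node00.Record12BgRowCoDivBridge
import Literature.MathematicalPhysics.QuantumFieldTheory.Balaban1983to89.Node00.CriticalOnFibreTopCore
import Literature.MathematicalPhysics.QuantumFieldTheory.Balaban1983to89.B10Eq6DensityLevel
import Literature.MathematicalPhysics.QuantumLattice.SpinOperators
import HarnessLib

/-!
# NEG-hPcol piece (N3c): **THE AXIS-PER-DIRECTION PAULI LATTICE `U_s` IS PRINTED-REGULAR FOR SMALL `s`** — `U_s ∈ 𝔘_k(ρ)` (`RegPr`: plaquette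
# clause AND covariant-divergence clause of [Balaban1985Variational] (2)) for `0 < s ≤ s₁(ρ, L, K − n)`

Cell `ym3-torus` (YM ladder rung R3 = continuum SU(2) Yang–Mills on T³ — a RUNG, NOT d = 4, NOT infinite volume, NOT a mass gap, NOT the Clay
problem), width seat `ym3-torus-px13` (gen 10), crux of record `MinimiserStabilityRegPr` (stmt-QuantumFields-19200, route `UnitScaleTilt`).
★★OWNER WORD 38 (2026-08-29T18:26Z) «NEG-hPcol — GO»: a kernel certificate that the S42ᴸ display row `hPcol` (pre-`Lift` text, ✓p729698) is NOT
inhabitable on px12 g11's explicit stratum-(c) family (LOCATE v2.1 8aced68d)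
`U_s(b) := expHerm ((s·θ((b₋)_{dir b} mod L)) • σ_{dir b})`, `θ = (1, −1, 0, …)`; px12 g11's NAMING LINE (18:30:32Z ∕ 18:41:38Z) + N3 SIGNATURE (19:08:46Z,
«N3c free for a hand») cut it into pieces; THIS FILE is piece **(N3c)** = SPEC-0 e654b2a4 `spec_regPr_field` TOKEN FOR TOKEN: for every radius `ρ > 0`
there is `s₁ > 0` with `U_s ∈ RegPr F n K ρ` for all `0 < s ≤ s₁`.

THE POINT (why this is S-sized): EXISTENCE of `s₁` needs only bounds LINEAR in `s` — every link is `s`-close to `1` (px6 g11's (N2a)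
✓`dist1_expHerm_smul_pauli_le`, `|θ| ≤ 1`), so every plaquette variable is `4s`-close to `1` (lit ✓`B10Eq6DensityLevel.dist1_plaqHol_le`), and print's
covariant divergence `(D^{1*}_U ∂U)(b)` — a signed sum over the `d = 3` directions of transported plaquette deviations — has norm `≤ d·(2·4s) = 24s`
(lit ✓`Node00.Sect2.norm_coDivSum_le_of_stencil` read through the dictionary ✓`Node00.Sect2.covDivT_one_unitsField_toUField`).  With
`s₁ := ρ·L^{−3(K−n)}∕48` both clauses hold STRICTLY (`4s ≤ ρL^{−3(K−n)}∕12 < ρL^{−2(K−n)}`, `24s ≤ ρL^{−3(K−n)}∕2 < ρL^{−3(K−n)}`).  The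
`O(s²)` commutator structure of the plaquettes (LOCATE v2.1 (d)–(e)) is true but not needed here.

WHAT IS PROVED (def-free; ns `…Theorems.Prop7HPcolNegRegPr`):
* §1 `dist1_field_le` (`dist1 (U_s b) ≤ s`), ★ `dist1_plaqHol_field_le` (`dist1 (U_s(∂p)) ≤ 4s`), ★ `norm_covDivT_field_le` (`‖(D^{1*}∂U_s)(b)‖ ≤ 24s`).
* §2 ★★ `regPr_field_of_le` (`0 ≤ s`, `48s ≤ ρ·L^{−3(K−n)}`, `0 < ρ` ⟹ `RegPr F n K ρ U_s`), ★★★ `spec_regPr_field` (SPEC-0 N3c token for token,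
  `s₁ = ρ·L^{−3(K−n)}∕48`).

HONEST FRAMING.  Bookkeeping over landed letters; `hPcol` is a display BINDER — NEG-hPcol is negative knowledge of record for TARGET.md footnote 17v,
NOT an item refutation, NOT a display event, NOT progress on EX; nothing of EX ∕ the 13 print rows ∕ `hThm2S` ∕ 19200 ∕ any crux or rung statement
is proved here; the Yang–Mills mass gap is NOT proved.

References: T. Bałaban, CMP **102** (1985) 277–309 [Balaban1985Variational] ((2) p.278); CMP **99** (1985) 75–102 [Balaban1985RegularSpaces]
((1.1)–(1.2) p.76, (1.7)–(1.9) p.77); CMP **98** (1985) 17–51 [Balaban1985Averaging] ((19) p.21); CMP **102** (1985) 255–275 [Balaban1985UV3] ((4) p.256).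
-/

set_option autoImplicit false

noncomputable section

open scoped BigOperators Matrix.Norms.L2Operator

namespace Summit.QuantumFields.YangMills.Theorems.Prop7HPcolNegRegPr

open Literature.MathematicalPhysics.QuantumFieldTheory.Balaban1983to89
open Literature.MathematicalPhysics.QuantumFieldTheory.Balaban1983to89.T3ContinuumYM3Torus
open Literature.MathematicalPhysics.QuantumLattice (spinHalfPauli)
open B10Eq27TorusAxialLog (toUField unitsField)
open B10Eq68TorusRegularity (covDivT)
open B10Eq6DensityLevel (dist1_plaqHol_le)
open T3PrintedRegularMinimiser (RegPr DivSmall)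
open T3RegularMinimiser (regThreshold)
open Node00 (Sect2.covDivT_one_unitsField_toUField Sect2.norm_coDivSum_le_of_stencil)
open Summit.QuantumFields.YangMills.Theorems.Prop7TPrint (expHerm expHermField expHermField_apply)
open Summit.QuantumFields.YangMills.Theorems.Prop7HPcolNegPauliExp (dist1_expHerm_smul_pauli_le)

variable (F : T3Family) (K : ℕ)

/-! ## §1 Links, plaquettes and the covariant divergence of `U_s` are `O(s)` -/

/-- Every link of `U_s` is `s`-close to `1`: `dist1 (U_s(b)) ≤ |s·θ| ≤ s` (px6 g11's ✓`dist1_expHerm_smul_pauli_le`, `|θ| ≤ 1`).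
[cite: Balaban1985Averaging, (19) p.21; Balaban1985Variational, (112) p.294] -/
theorem dist1_field_le (s : ℝ) (hs : 0 ≤ s) (b : PBond (F.P K) 0) :
    GaugeGroup.dist1 (expHermField (F := F) (K := K)
      (fun b : PBond (F.P K) 0 =>
        (((s * (if (b.src b.dir).val % F.L = 0 then (1 : ℝ) else if (b.src b.dir).val % F.L = 1 then -1 else 0)) : ℝ) : ℂ) •
          spinHalfPauli b.dir) b) ≤ s := by
  rw [expHermField_apply]
  refine (dist1_expHerm_smul_pauli_le _ _).trans ?_
  have hθ : |(if (b.src b.dir).val % F.L = 0 then (1 : ℝ) else if (b.src b.dir).val % F.L = 1 then -1 else 0)| ≤ 1 := by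
    split_ifs <;> simp
  rw [abs_mul, abs_of_nonneg hs]
  nlinarith

/-- ★ Every plaquette variable of `U_s` is `4s`-close to `1` (subadditivity of `dist1` along the plaquette boundary, lit ✓`dist1_plaqHol_le`).
[cite: Balaban1985UV3, (4) p.256; Balaban1985Variational, (2) p.278] -/
theorem dist1_plaqHol_field_le (s : ℝ) (hs : 0 ≤ s) (p : Plaq (F.P K) 0) :
    GaugeGroup.dist1 (GaugeField.plaqHol (expHermField (F := F) (K := K)
      (fun b : PBond (F.P K) 0 =>
        (((s * (if (b.src b.dir).val % F.L = 0 then (1 : ℝ) else if (b.src b.dir).val % F.L = 1 then -1 else 0)) : ℝ) : ℂ) •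
          spinHalfPauli b.dir)) p) ≤ 4 * s := by
  refine (dist1_plaqHol_le _ p).trans ?_
  have h := dist1_field_le F K s hs
  linarith [h ⟨p.src, p.μ⟩, h ⟨p.src.shift p.μ, p.ν⟩, h ⟨p.src.shift p.ν, p.μ⟩, h ⟨p.src, p.ν⟩]

/-- ★ Print's covariant divergence of the plaquette field of `U_s` at unit spacing is `24s`-small at every bond: `(D^{1*}_U ∂U)_μ(x)` is a signed sum
over the `d = 3` directions of transported plaquette deviations, each `≤ 2·4s` (lit ✓`Sect2.norm_coDivSum_le_of_stencil` through the dictionary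
✓`Sect2.covDivT_one_unitsField_toUField`). [cite: Balaban1985RegularSpaces, (1.1)–(1.2) p.76, (1.9) p.77] -/
theorem norm_covDivT_field_le (s : ℝ) (hs : 0 ≤ s) (b : PBond (F.P K) 0) :
    ‖covDivT 1 (unitsField (toUField (expHermField (F := F) (K := K)
      (fun b : PBond (F.P K) 0 =>
        (((s * (if (b.src b.dir).val % F.L = 0 then (1 : ℝ) else if (b.src b.dir).val % F.L = 1 then -1 else 0)) : ℝ) : ℂ) •
          spinHalfPauli b.dir)))) b.dir b.src‖ ≤ 24 * s := by
  have hd : ((F.P K).d : ℝ) = 3 := by rw [T3Family.P_d]; norm_num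
  have h := dist1_plaqHol_field_le F K s hs
  rw [Sect2.covDivT_one_unitsField_toUField]
  refine (Sect2.norm_coDivSum_le_of_stencil _ (by positivity : (0 : ℝ) ≤ 4 * s) b.src b.dir
    (fun ν hν => ⟨h _, h _⟩) (fun ν hν => ⟨h _, h _⟩)).trans ?_
  rw [hd]
  linarith

/-! ## §2 `U_s ∈ 𝔘_k(ρ)` for `48s ≤ ρ·L^{−3(K−n)}` -/

variable (n : ℕ)

/-- ★★ **`U_s ∈ RegPr F n K ρ` FOR `0 ≤ s`, `48·s ≤ ρ·L^{−3(K−n)}`, `0 < ρ`**: the plaquette clause `dist1 (U_s(∂p)) < ρ·L^{−2(K−n)}`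
(`4s ≤ ρL^{−3(K−n)}∕12 < ρL^{−2(K−n)}` since `L^{−3(K−n)} ≤ L^{−2(K−n)}`) and the divergence clause `‖(D^{1*}∂U_s)(b)‖ < ρ·L^{−3(K−n)}`
(`24s ≤ ρL^{−3(K−n)}∕2`). [cite: Balaban1985Variational, (2) p.278; Balaban1985RegularSpaces, (1.7)–(1.9) p.77] -/
theorem regPr_field_of_le {ρ s : ℝ} (hρ : 0 < ρ) (hs : 0 ≤ s) (hsρ : 48 * s ≤ ρ * ((F.L : ℝ)⁻¹) ^ (3 * (K - n))) :
    RegPr F n K ρ (expHermField (F := F) (K := K)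
      (fun b : PBond (F.P K) 0 =>
        (((s * (if (b.src b.dir).val % F.L = 0 then (1 : ℝ) else if (b.src b.dir).val % F.L = 1 then -1 else 0)) : ℝ) : ℂ) •
          spinHalfPauli b.dir)) := by
  have hL1 : (1 : ℝ) ≤ F.L := by have := F.hL.2; exact_mod_cast this.le
  have hLi0 : (0 : ℝ) ≤ (F.L : ℝ)⁻¹ := inv_nonneg.mpr (by positivity)
  have hLi1 : (F.L : ℝ)⁻¹ ≤ 1 := inv_le_one_of_one_le₀ hL1
  have h3 : (0 : ℝ) < ρ * ((F.L : ℝ)⁻¹) ^ (3 * (K - n)) := by positivity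
  have h32 : ((F.L : ℝ)⁻¹) ^ (3 * (K - n)) ≤ ((F.L : ℝ)⁻¹) ^ (2 * (K - n)) := pow_le_pow_of_le_one hLi0 hLi1 (by omega)
  refine ⟨fun p => ?_, fun b => ?_⟩
  · refine (dist1_plaqHol_field_le F K s hs p).trans_lt ?_
    unfold regThreshold
    have : ρ * ((F.L : ℝ)⁻¹) ^ (3 * (K - n)) ≤ ρ * ((F.L : ℝ)⁻¹) ^ (2 * (K - n)) := mul_le_mul_of_nonneg_left h32 hρ.le
    linarith
  · refine (norm_covDivT_field_le F K s hs b).trans_lt ?_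
    linarith

/-- ★★★ **SPEC-0 N3c (px12 g11 e654b2a4) — `U_s ∈ 𝔘_k(ρ)` FOR SMALL `s`, TOKEN FOR TOKEN**: for every `ρ > 0`, with `s₁ := ρ·L^{−3(K−n)}∕48`, every
`0 < s ≤ s₁` gives `RegPr F n K ρ U_s` (both clauses of [Balaban1985Variational] (2)). [cite: Balaban1985Variational, (2) p.278; Balaban1985RegularSpaces, (1.7)–(1.9) p.77] -/
theorem spec_regPr_field (ρ : ℝ) (hρ : 0 < ρ) : ∃ s₁ : ℝ, 0 < s₁ ∧ ∀ s : ℝ, 0 < s → s ≤ s₁ → RegPr F n K ρ (expHermField (F := F) (K := K)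
      (fun b : PBond (F.P K) 0 =>
        (((s * (if (b.src b.dir).val % F.L = 0 then (1 : ℝ) else if (b.src b.dir).val % F.L = 1 then -1 else 0)) : ℝ) : ℂ) •
          spinHalfPauli b.dir)) := by
  have hL : (0 : ℝ) < F.L := by have := F.hL.2; exact_mod_cast (by omega : 0 < F.L)
  refine ⟨ρ * ((F.L : ℝ)⁻¹) ^ (3 * (K - n)) / 48, by positivity, fun s hs hs₁ => ?_⟩
  exact regPr_field_of_le F K n hρ hs.le (by linarith)

end Summit.QuantumFields.YangMills.Theorems.Prop7HPcolNegRegPr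

end
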